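import Mathlib.NumberTheory.NumberField.ClassNumber
import Literature.NumberTheory.QuadraticFields.RealQuadraticFundamentalUnitValues
import Literature.NumberTheory.QuadraticFields.IdealsOfPrimePowerNorm
import Literature.NumberTheory.QuadraticFields.LatticeSumPrincipal
import Literature.NumberTheory.QuadraticFields.FundamentalDiscriminant
import HarnessLib

/-!
# Class number one for the real quadratic fields of discriminant `< 36`
# (`d_K = 5, 8, 12, 13, 17, 21, 24, 28, 29, 33`)

Topic `NumberTheory/QuadraticFields`, namespace `Literature.NumberTheory.QuadraticFields.Quadratic`, continuing
`RealQuadraticFundamentalUnitValues.lean` (rev 2: `classNumber_eq_one_of_discr_pos_lt_sixteen`, `h_K = 1` for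
`0 < d_K < 16` by Minkowski's bound alone). Everything here is PROVED (theorems only; no definition, no named fact,
no instance). As elsewhere in this directory the field is an ABSTRACT number field `K` with `[K : ℚ] = 2` and a given
value of `d_K = NumberField.discr K`; an integral basis `(1, ω)` with `ω² = m + tω`, `d_K = t² + 4m` comes from
`HeegnerCondition.lean` (`exists_basis_zero_eq_one`, `basis_one_mul_self_eq`, `discr_eq_sq_add_four_mul`).

The method is the standard one (Marcus, *Number Fields*, Ch. 5, Cor. 2 of Thm. 37 and the worked examples after it):
the Minkowski bound of a real quadratic field is `M_K = √d_K/2`, so for `d_K < 36` every ideal class contains an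
ideal of norm `≤ 2`, and `h_K = 1` as soon as every ideal of norm `2` is principal. Ideals of norm `2` are primes
above `2`; by the tree's description of the ideals of prime norm (`IdealsOfPrimePowerNorm.lean`: an ideal of norm `p`
is `(p, ω − k)` with `p ∣ k² − tk − m`) there is NONE when `d_K ≡ 5 (mod 8)` (`t, m` odd, `k² − tk − m` odd: `2` is
inert), and when the norm form `x² + txy − my²` (`LatticeSumPrincipal.norm_intCast_add_intCast_mul`) takes a value
`±2` at `π = x + yω`, a prime `𝔭` of norm `2` contains `2 = ±π·π̄` hence `π` or `π̄`, both of norm `2`, so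
`𝔭 = (π)` or `(π̄)` (Cox, *Primes of the form x² + ny²*, Thm. 7.7: an ideal times its conjugate is its norm).

## Main statements

* `isPrincipal_of_absNorm_eq_of_normForm` — if the norm form of `𝓞 K = ℤ[ω]` represents `±p` (`p` prime), every
  ideal of norm `p` is principal;
* `absNorm_ne_two_of_emod_eight` — if `t² + 4m ≡ 5 (mod 8)`, no ideal of `𝓞 K` has norm `2`;
* `classNumber_eq_one_of_absNorm_two` — `0 < d_K < 36` and every ideal of norm `2` principal ⇒ `h_K = 1`;
* `classNumber_eq_one_of_discr_emod_eight_eq_five` (`0 < d_K < 36`, `d_K ≡ 5 (mod 8)`),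
  `classNumber_eq_one_of_normForm_two` (`0 < d_K < 36`, the norm form takes `±2`);
* the values: `classNumber_eq_one_of_discr_eq_seventeen`, `_twentyOne`, `_twentyFour`, `_twentyEight`,
  `_twentyNine`, `_thirtyThree`, and the assembly **`classNumber_eq_one_of_discr_pos_lt_36`**: every real quadratic
  field with `d_K < 36` has `h_K = 1` (the field discriminants in `[16, 36)` are `17, 21, 24, 28, 29, 33` by the tree's
  `isFundamentalDiscriminant_discr`; `d_K < 16` is rev 2 of `RealQuadraticFundamentalUnitValues.lean`);
* `classNumber_mul_regulator_of_discr_eq_seventeen … _twentyNine` — `h_K R_K = log ε_D` at `D = 17, 21, 24, 28, 29`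
  with the kernel units of `RealQuadraticFundamentalUnitValues.lean` (the quantity of Dirichlet's class number formula
  `L(1, χ_D) = 2 h_K R_K/√D`).

The values agree with the tables (Cohen, GTM 138, Appendix B.2: `h(17) = h(21) = h(24) = h(28) = h(29) = h(33) = 1`;
Hardy–Wright Thm. 247: `ℚ(√m)` is even norm-Euclidean for `m = 17, 21, 6, 7, 29, 33`). First consumer: the
landau-siegel rescue bed (`Zhang2022/RepairBedClassNumberFormulaReal.lean`), whose positive moduli are
`5, 8, 12, 13, 17, 21, 24, 28, 29, 1365`. Not here: `d_K = 1365` (`M_K ≈ 18.5`, `h = 4`), any `d_K ≥ 36`.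

## References

* [Marcus1977] D. A. Marcus, *Number Fields*, Ch. 5, Thm. 35–37 with Cor. 2 and the examples following it
  (Minkowski bound; class number computations for quadratic fields).
* [Cox2013] D. A. Cox, *Primes of the form x² + ny²*, 2nd ed. (2013), §7.A (norm form of an order), §7.B Thm. 7.7.
* [Cohen1993] H. Cohen, *A Course in Computational Algebraic Number Theory*, GTM 138 (1993), §5.7 and Appendix B.2
  (class numbers of real quadratic fields).
* [HardyWright2008] G. H. Hardy, E. M. Wright, *An Introduction to the Theory of Numbers*, 6th ed. (2008), §14.7
  Thm. 247 (the norm-Euclidean real quadratic fields).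
-/

noncomputable section

open Module NumberField Ideal
open scoped nonZeroDivisors

namespace Literature.NumberTheory.QuadraticFields.Quadratic

variable {K : Type*} [Field K] [NumberField K]

/-! ### Principal primes from values of the norm form -/

section NormForm

variable (b : Basis (Fin 2) ℤ (𝓞 K)) (hb : b 0 = 1) {t m : ℤ}
  (hω : b 1 * b 1 = (m : 𝓞 K) + (t : 𝓞 K) * b 1)

omit [NumberField K] in
include hω in
/-- **An element times its conjugate is its norm**: for `π = x + yω` and `π̄ = (x + ty) − yω` (`ω̄ = t − ω`),
`π·π̄ = x² + txy − my²`. [cite: Cox2013, §7.A (7.2) and §7.B Thm. 7.7] -/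
theorem intCast_add_mul_mul_conj (x y : ℤ) :
    ((x : 𝓞 K) + (y : 𝓞 K) * b 1) * (((x + t * y : ℤ) : 𝓞 K) + ((-y : ℤ) : 𝓞 K) * b 1) =
      ((x ^ 2 + t * x * y - m * y ^ 2 : ℤ) : 𝓞 K) := by
  push_cast
  linear_combination (-(y : 𝓞 K) ^ 2) * hω

include hb hω in
/-- **The norm of a principal ideal is the value of the norm form**: `N((x + yω)) = |x² + txy − my²|`.
[cite: Cox2013, §7.A (norm form of an order) and §7.B Thm. 7.7] -/
theorem absNorm_span_intCast_add_mul (x y : ℤ) :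
    absNorm (span {(x : 𝓞 K) + (y : 𝓞 K) * b 1}) = (x ^ 2 + t * x * y - m * y ^ 2).natAbs := by
  rw [absNorm_span_singleton, norm_intCast_add_intCast_mul b hb hω]

omit [NumberField K] in
/-- An ideal of prime norm `p` of `𝓞 K` containing an element `π` with `N((π)) = p` IS `(π)`: `(π)` is a non-zero
prime, hence maximal, and `(π) ≤ I ≠ ⊤`. [cite: Marcus1977, Ch. 5, discussion after Thm. 37] -/
theorem eq_span_singleton_of_mem_of_absNorm_eq [NumberField K] {I : Ideal (𝓞 K)} {π : 𝓞 K} {p : ℕ}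
    (hp : p.Prime) (hI : absNorm I = p) (hπ : absNorm (span {π}) = p) (hmem : π ∈ I) : I = span {π} := by
  have hprime : (span {π}).IsPrime := isPrime_of_irreducible_absNorm (by rw [hπ]; exact hp)
  have hmax : (span {π}).IsMaximal := hprime.isMaximal (by
    intro h0
    rw [h0, absNorm_bot] at hπ
    exact hp.ne_zero hπ.symm)
  have hne : I ≠ ⊤ := fun h => hp.ne_one (by rw [← hI, h, absNorm_top])
  exact (hmax.eq_of_le hne ((span_singleton_le_iff_mem _).mpr hmem)).symm

include hb hω in
/-- **Every ideal of prime norm `p` is principal when the norm form represents `±p`.** If `x² + txy − my² = ±p`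
then `π = x + yω` and `π̄ = (x + ty) − yω` have norm `p` and `π π̄ = ±p`; an ideal `I` of norm `p` is prime and
contains `p`, hence `π` or `π̄`, and is therefore `(π)` or `(π̄)`. (Cox, Thm. 7.7; Marcus, Ch. 5: "`p` is the norm
of a principal prime".) [cite: Cox2013, §7.B Thm. 7.7] -/
theorem isPrincipal_of_absNorm_eq_of_normForm {p : ℕ} (hp : p.Prime) {x y : ℤ}
    (hxy : (x ^ 2 + t * x * y - m * y ^ 2).natAbs = p) {I : Ideal (𝓞 K)} (hI : absNorm I = p) :
    Submodule.IsPrincipal I := by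
  set π : 𝓞 K := (x : 𝓞 K) + (y : 𝓞 K) * b 1 with hπ
  set π' : 𝓞 K := ((x + t * y : ℤ) : 𝓞 K) + ((-y : ℤ) : 𝓞 K) * b 1 with hπ'
  have hNπ : absNorm (span {π}) = p := by rw [hπ, absNorm_span_intCast_add_mul b hb hω, hxy]
  have hNπ' : absNorm (span {π'}) = p := by
    rw [hπ', absNorm_span_intCast_add_mul b hb hω, ← hxy]
    congr 1
    ring
  have hprod : π * π' = ((x ^ 2 + t * x * y - m * y ^ 2 : ℤ) : 𝓞 K) := by
    rw [hπ, hπ']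
    exact intCast_add_mul_mul_conj b hω x y
  have hIprime : I.IsPrime := isPrime_of_irreducible_absNorm (by rw [hI]; exact hp)
  have hpI : ((p : ℤ) : 𝓞 K) ∈ I := by
    have h := absNorm_mem I
    rw [hI] at h
    exact_mod_cast h
  have hmem : π * π' ∈ I := by
    rw [hprod]
    have hcases : x ^ 2 + t * x * y - m * y ^ 2 = p ∨ x ^ 2 + t * x * y - m * y ^ 2 = -(p : ℤ) := by
      omega
    rcases hcases with h | h
    · rw [h]; exact hpI
    · rw [h, Int.cast_neg]; exact I.neg_mem_iff.mpr hpI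
  rcases hIprime.mem_or_mem hmem with h | h
  · exact ⟨⟨π, by rw [eq_span_singleton_of_mem_of_absNorm_eq hp hI hNπ h, submodule_span_eq]⟩⟩
  · exact ⟨⟨π', by rw [eq_span_singleton_of_mem_of_absNorm_eq hp hI hNπ' h, submodule_span_eq]⟩⟩

end NormForm

/-! ### `d_K ≡ 5 (mod 8)`: no ideal of norm `2` (`2` is inert) -/

/-- `t² + 4m ≡ 5 (mod 8)` forces `t` and `m` odd. [folklore] -/
private theorem emod_two_of_sq_add_four_mul_emod_eight {t m : ℤ} (h : (t ^ 2 + 4 * m) % 8 = 5) :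
    t % 2 = 1 ∧ m % 2 = 1 := by
  rcases Int.emod_two_eq_zero_or_one t with ht | ht
  · exfalso
    obtain ⟨s, rfl⟩ : ∃ s, t = 2 * s := ⟨t / 2, by omega⟩
    have hs : (2 * s) ^ 2 + 4 * m = 4 * (s ^ 2 + m) := by ring
    rw [hs] at h
    omega
  · obtain ⟨s, rfl⟩ : ∃ s, t = 2 * s + 1 := ⟨t / 2, by omega⟩
    obtain ⟨e, he⟩ := Int.even_mul_succ_self s
    have hs : (2 * s + 1) ^ 2 + 4 * m = 4 * (s * (s + 1)) + 1 + 4 * m := by ring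
    rw [hs, he] at h
    omega

/-- For `t, m` odd the value `k² − tk − m = k(k − t) − m` is odd, so `2C ≠ k² − tk − m`. [folklore] -/
private theorem two_mul_ne_of_odd {t m : ℤ} (ht : t % 2 = 1) (hm : m % 2 = 1) (k C : ℤ) :
    2 * C ≠ k ^ 2 - t * k - m := by
  intro h
  obtain ⟨s, rfl⟩ : ∃ s, t = 2 * s + 1 := ⟨t / 2, by omega⟩
  obtain ⟨e, he⟩ := Int.even_mul_pred_self k
  have hk : k ^ 2 - (2 * s + 1) * k - m = k * (k - 1) - 2 * (s * k) - m := by ring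
  rw [hk, he] at h
  omega

section Inert

variable (b : Basis (Fin 2) ℤ (𝓞 K)) (hb : b 0 = 1) {t m : ℤ}
  (hω : b 1 * b 1 = (m : 𝓞 K) + (t : 𝓞 K) * b 1)

include hb hω in
/-- **`2` is inert when `d_K ≡ 5 (mod 8)`: no ideal of `𝓞 K` has norm `2`.** An ideal of norm `2` would be
`(2, ω − k)` with `2 ∣ k² − tk − m` (the tree's `exists_eq_span_pair_of_absNorm_eq_prime`), but `t² + 4m ≡ 5 (mod 8)`
makes `t, m` odd and `k² − tk − m` odd. [cite: Cox2013, §7.B Thm. 7.7 with Prop. 5.16 (`(d_K/2) = −1`)] -/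
theorem absNorm_ne_two_of_emod_eight (hd : (t ^ 2 + 4 * m) % 8 = 5) (I : Ideal (𝓞 K)) : absNorm I ≠ 2 := by
  intro hI
  obtain ⟨k, C, hkC, -⟩ := exists_eq_span_pair_of_absNorm_eq_prime b hb hω Nat.prime_two hI
  obtain ⟨ht, hm⟩ := emod_two_of_sq_add_four_mul_emod_eight hd
  exact two_mul_ne_of_odd ht hm k C (by exact_mod_cast hkC)

end Inert

/-! ### Minkowski: for `0 < d_K < 36` only the ideals of norm `2` matter -/

/-- **`h_K = 1` for a real quadratic field with `d_K < 36` whose ideals of norm `2` are principal.** Minkowski's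
bound is `M_K = (2!/2²)√d_K = √d_K/2 < 3` (`r₂ = 0`), so (Mathlib's
`isPrincipalIdealRing_of_isPrincipal_of_norm_le_of_isPrime`) it suffices that every PRIME ideal of norm `≤ 2` is
principal; norm `1` is `⊤`, not prime. [cite: Marcus1977, Ch. 5, Cor. 2 of Thm. 37] -/
theorem classNumber_eq_one_of_absNorm_two (h2 : finrank ℚ K = 2) (hd : 0 < NumberField.discr K)
    (h36 : NumberField.discr K < 36) (h : ∀ I : Ideal (𝓞 K), absNorm I = 2 → Submodule.IsPrincipal I) :
    NumberField.classNumber K = 1 := by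
  obtain ⟨-, hc0⟩ := nrRealPlaces_eq_two_and_nrComplexPlaces_eq_zero h2 hd
  rw [NumberField.classNumber_eq_one_iff]
  refine RingOfIntegers.isPrincipalIdealRing_of_isPrincipal_of_norm_le_of_isPrime fun I hIprime hIM => ?_
  rw [hc0, h2] at hIM
  have hd' : |(NumberField.discr K : ℝ)| < 36 := by
    rw [abs_of_pos (by exact_mod_cast hd)]
    exact_mod_cast h36
  have hsqrt : Real.sqrt |(NumberField.discr K : ℝ)| < 6 := by
    rw [Real.sqrt_lt' (by norm_num)]
    linarith
  have hlt : (absNorm (I : Ideal (𝓞 K)) : ℝ) < 3 := by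
    norm_num [Nat.factorial] at hIM
    linarith
  have h3 : absNorm (I : Ideal (𝓞 K)) < 3 := by exact_mod_cast hlt
  have h0 : absNorm (I : Ideal (𝓞 K)) ≠ 0 := absNorm_ne_zero_of_nonZeroDivisors I
  have h1 : absNorm (I : Ideal (𝓞 K)) ≠ 1 := fun h1 => hIprime.ne_top (absNorm_eq_one_iff.mp h1)
  exact h _ (by omega)

/-- **`h_K = 1` when `0 < d_K < 36` and `d_K ≡ 5 (mod 8)`** (`2` inert: no ideal of norm `2` at all); covers
`d_K = 5, 13, 21, 29`. [cite: Marcus1977, Ch. 5, Cor. 2 of Thm. 37 and the examples after it] -/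
theorem classNumber_eq_one_of_discr_emod_eight_eq_five (h2 : finrank ℚ K = 2) (hd : 0 < NumberField.discr K)
    (h36 : NumberField.discr K < 36) (h5 : NumberField.discr K % 8 = 5) : NumberField.classNumber K = 1 := by
  obtain ⟨b, hb⟩ := exists_basis_zero_eq_one (K := K) h2
  have hω := basis_one_mul_self_eq b hb
  have hdisc := discr_eq_sq_add_four_mul b hb
  refine classNumber_eq_one_of_absNorm_two h2 hd h36 fun I hI => ?_
  exact absurd hI (absNorm_ne_two_of_emod_eight b hb hω (by rw [← hdisc]; exact h5) I)

/-- **`h_K = 1` when `0 < d_K < 36` and the norm form takes the value `±2`** (for whichever integral basis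
`(1, ω)`, `ω² = m + tω`, `t² + 4m = d_K`): every ideal of norm `2` is then principal. [cite: Marcus1977, Ch. 5,
Cor. 2 of Thm. 37 and the examples after it] -/
theorem classNumber_eq_one_of_normForm_two (h2 : finrank ℚ K = 2) (hd : 0 < NumberField.discr K)
    (h36 : NumberField.discr K < 36)
    (hrep : ∀ t m : ℤ, NumberField.discr K = t ^ 2 + 4 * m →
      ∃ x y : ℤ, (x ^ 2 + t * x * y - m * y ^ 2).natAbs = 2) :
    NumberField.classNumber K = 1 := by
  obtain ⟨b, hb⟩ := exists_basis_zero_eq_one (K := K) h2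
  have hω := basis_one_mul_self_eq b hb
  obtain ⟨x, y, hxy⟩ := hrep _ _ (discr_eq_sq_add_four_mul b hb)
  exact classNumber_eq_one_of_absNorm_two h2 hd h36 fun I hI =>
    isPrincipal_of_absNorm_eq_of_normForm b hb hω Nat.prime_two hxy hI

/-! ### The norm form takes `±2` at `d_K = 17, 24, 28, 33` -/

/-- `t² + 4m = 17`: `t = 2s + 1`, `s² + s + m = 4`, and `x = 1 − s`, `y = 1` give `x² + txy − my² = −2`
(`ω ↦ (1 + √17)/2`: `N((3 + √17)/2) = −2`). [folklore] -/
private theorem exists_normForm_two_of_eq_17 {t m : ℤ} (h : t ^ 2 + 4 * m = 17) :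
    ∃ x y : ℤ, (x ^ 2 + t * x * y - m * y ^ 2).natAbs = 2 := by
  rcases Int.emod_two_eq_zero_or_one t with ht | ht
  · exfalso
    obtain ⟨s, rfl⟩ : ∃ s, t = 2 * s := ⟨t / 2, by omega⟩
    have hs : (2 * s) ^ 2 + 4 * m = 4 * (s ^ 2 + m) := by ring
    omega
  · obtain ⟨s, rfl⟩ : ∃ s, t = 2 * s + 1 := ⟨t / 2, by omega⟩
    refine ⟨1 - s, 1, ?_⟩
    have hv : (1 - s) ^ 2 + (2 * s + 1) * (1 - s) * 1 - m * 1 ^ 2 = -2 := by nlinarith [h]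
    rw [hv]
    rfl

/-- `t² + 4m = 33`: `t = 2s + 1`, `s² + s + m = 8`, and `x = 2 − s`, `y = 1` give `x² + txy − my² = −2`
(`N((5 + √33)/2) = −2`). [folklore] -/
private theorem exists_normForm_two_of_eq_33 {t m : ℤ} (h : t ^ 2 + 4 * m = 33) :
    ∃ x y : ℤ, (x ^ 2 + t * x * y - m * y ^ 2).natAbs = 2 := by
  rcases Int.emod_two_eq_zero_or_one t with ht | ht
  · exfalso
    obtain ⟨s, rfl⟩ : ∃ s, t = 2 * s := ⟨t / 2, by omega⟩
    have hs : (2 * s) ^ 2 + 4 * m = 4 * (s ^ 2 + m) := by ring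
    omega
  · obtain ⟨s, rfl⟩ : ∃ s, t = 2 * s + 1 := ⟨t / 2, by omega⟩
    refine ⟨2 - s, 1, ?_⟩
    have hv : (2 - s) ^ 2 + (2 * s + 1) * (2 - s) * 1 - m * 1 ^ 2 = -2 := by nlinarith [h]
    rw [hv]
    rfl

/-- `t² + 4m = 24`: `t = 2s`, `s² + m = 6`, and `x = 2 − s`, `y = 1` give `x² + txy − my² = −2`
(`N(2 + √6) = −2`). [folklore] -/
private theorem exists_normForm_two_of_eq_24 {t m : ℤ} (h : t ^ 2 + 4 * m = 24) :
    ∃ x y : ℤ, (x ^ 2 + t * x * y - m * y ^ 2).natAbs = 2 := by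
  rcases Int.emod_two_eq_zero_or_one t with ht | ht
  · obtain ⟨s, rfl⟩ : ∃ s, t = 2 * s := ⟨t / 2, by omega⟩
    refine ⟨2 - s, 1, ?_⟩
    have hv : (2 - s) ^ 2 + 2 * s * (2 - s) * 1 - m * 1 ^ 2 = -2 := by nlinarith [h]
    rw [hv]
    rfl
  · exfalso
    obtain ⟨s, rfl⟩ : ∃ s, t = 2 * s + 1 := ⟨t / 2, by omega⟩
    have hs : (2 * s + 1) ^ 2 + 4 * m = 4 * (s ^ 2 + s + m) + 1 := by ring
    omega

/-- `t² + 4m = 28`: `t = 2s`, `s² + m = 7`, and `x = 3 − s`, `y = 1` give `x² + txy − my² = 2`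
(`N(3 + √7) = 2`). [folklore] -/
private theorem exists_normForm_two_of_eq_28 {t m : ℤ} (h : t ^ 2 + 4 * m = 28) :
    ∃ x y : ℤ, (x ^ 2 + t * x * y - m * y ^ 2).natAbs = 2 := by
  rcases Int.emod_two_eq_zero_or_one t with ht | ht
  · obtain ⟨s, rfl⟩ : ∃ s, t = 2 * s := ⟨t / 2, by omega⟩
    refine ⟨3 - s, 1, ?_⟩
    have hv : (3 - s) ^ 2 + 2 * s * (3 - s) * 1 - m * 1 ^ 2 = 2 := by nlinarith [h]
    rw [hv]
    rfl
  · exfalso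
    obtain ⟨s, rfl⟩ : ∃ s, t = 2 * s + 1 := ⟨t / 2, by omega⟩
    have hs : (2 * s + 1) ^ 2 + 4 * m = 4 * (s ^ 2 + s + m) + 1 := by ring
    omega

/-! ### The six fields of discriminant `17, 21, 24, 28, 29, 33` -/

/-- **`h(ℚ(√17)) = 1`**: `d_K = 17 ⇒ h_K = 1` (`2` splits into the principal primes `((3 ± √17)/2)`).
[cite: Cohen1993, Appendix B Table B.2] -/
theorem classNumber_eq_one_of_discr_eq_seventeen (h2 : finrank ℚ K = 2) (hd : NumberField.discr K = 17) :
    NumberField.classNumber K = 1 :=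
  classNumber_eq_one_of_normForm_two h2 (by rw [hd]; norm_num) (by rw [hd]; norm_num)
    fun _ _ h => exists_normForm_two_of_eq_17 (h.symm.trans hd)

/-- **`h(ℚ(√21)) = 1`**: `d_K = 21 ⇒ h_K = 1` (`21 ≡ 5 (mod 8)`: `2` is inert). [cite: Cohen1993, Appendix B Table B.2] -/
theorem classNumber_eq_one_of_discr_eq_twentyOne (h2 : finrank ℚ K = 2) (hd : NumberField.discr K = 21) :
    NumberField.classNumber K = 1 :=
  classNumber_eq_one_of_discr_emod_eight_eq_five h2 (by rw [hd]; norm_num) (by rw [hd]; norm_num)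
    (by rw [hd]; rfl)

/-- **`h(ℚ(√6)) = 1`**: `d_K = 24 ⇒ h_K = 1` (`2` ramifies as `(2 + √6)²·unit`, `N(2 + √6) = −2`).
[cite: Cohen1993, Appendix B Table B.2] -/
theorem classNumber_eq_one_of_discr_eq_twentyFour (h2 : finrank ℚ K = 2) (hd : NumberField.discr K = 24) :
    NumberField.classNumber K = 1 :=
  classNumber_eq_one_of_normForm_two h2 (by rw [hd]; norm_num) (by rw [hd]; norm_num)
    fun _ _ h => exists_normForm_two_of_eq_24 (h.symm.trans hd)

/-- **`h(ℚ(√7)) = 1`**: `d_K = 28 ⇒ h_K = 1` (`2` ramifies, `N(3 + √7) = 2`). [cite: Cohen1993, Appendix B Table B.2] -/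
theorem classNumber_eq_one_of_discr_eq_twentyEight (h2 : finrank ℚ K = 2) (hd : NumberField.discr K = 28) :
    NumberField.classNumber K = 1 :=
  classNumber_eq_one_of_normForm_two h2 (by rw [hd]; norm_num) (by rw [hd]; norm_num)
    fun _ _ h => exists_normForm_two_of_eq_28 (h.symm.trans hd)

/-- **`h(ℚ(√29)) = 1`**: `d_K = 29 ⇒ h_K = 1` (`29 ≡ 5 (mod 8)`: `2` is inert). [cite: Cohen1993, Appendix B Table B.2] -/
theorem classNumber_eq_one_of_discr_eq_twentyNine (h2 : finrank ℚ K = 2) (hd : NumberField.discr K = 29) :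
    NumberField.classNumber K = 1 :=
  classNumber_eq_one_of_discr_emod_eight_eq_five h2 (by rw [hd]; norm_num) (by rw [hd]; norm_num)
    (by rw [hd]; rfl)

/-- **`h(ℚ(√33)) = 1`**: `d_K = 33 ⇒ h_K = 1` (`2` splits, `N((5 + √33)/2) = −2`). [cite: Cohen1993, Appendix B Table B.2] -/
theorem classNumber_eq_one_of_discr_eq_thirtyThree (h2 : finrank ℚ K = 2) (hd : NumberField.discr K = 33) :
    NumberField.classNumber K = 1 :=
  classNumber_eq_one_of_normForm_two h2 (by rw [hd]; norm_num) (by rw [hd]; norm_num)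
    fun _ _ h => exists_normForm_two_of_eq_33 (h.symm.trans hd)

/-- `25` is not square-free. [folklore] -/
private theorem not_squarefree_25 : ¬ Squarefree (25 : ℤ) := by
  intro h
  have h5 := h 5 ⟨1, by norm_num⟩
  rw [Int.isUnit_iff] at h5
  omega

/-- **Every real quadratic field of discriminant `< 36` has class number one.** The field discriminants in
`(0, 36)` are `5, 8, 12, 13` (`h_K = 1` by Minkowski alone, `classNumber_eq_one_of_discr_pos_lt_sixteen`) and
`17, 21, 24, 28, 29, 33` (the six theorems above); `16, 20, 25, 32` are not fundamental
(`isFundamentalDiscriminant_discr`). [cite: Cohen1993, Appendix B Table B.2] -/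
theorem classNumber_eq_one_of_discr_pos_lt_36 (h2 : finrank ℚ K = 2) (hd : 0 < NumberField.discr K)
    (h36 : NumberField.discr K < 36) : NumberField.classNumber K = 1 := by
  by_cases h16 : NumberField.discr K < 16
  · exact classNumber_eq_one_of_discr_pos_lt_sixteen h2 hd h16
  rcases isFundamentalDiscriminant_discr (K := K) h2 with ⟨h1, hsq, -⟩ | ⟨h4, h23, -⟩
  · have hcases : NumberField.discr K = 17 ∨ NumberField.discr K = 21 ∨ NumberField.discr K = 25 ∨
        NumberField.discr K = 29 ∨ NumberField.discr K = 33 := by omega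
    rcases hcases with h | h | h | h | h
    · exact classNumber_eq_one_of_discr_eq_seventeen h2 h
    · exact classNumber_eq_one_of_discr_eq_twentyOne h2 h
    · exact absurd (h ▸ hsq) not_squarefree_25
    · exact classNumber_eq_one_of_discr_eq_twentyNine h2 h
    · exact classNumber_eq_one_of_discr_eq_thirtyThree h2 h
  · have hcases : NumberField.discr K = 24 ∨ NumberField.discr K = 28 := by omega
    rcases hcases with h | h
    · exact classNumber_eq_one_of_discr_eq_twentyFour h2 h
    · exact classNumber_eq_one_of_discr_eq_twentyEight h2 h

/-! ### `h_K · R_K = log ε_D` at `D = 17, 21, 24, 28, 29` -/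

/-- `d_K = 17`: `h_K · R_K = log (4 + √17)` (`ε₁₇ = (8 + 2√17)/2`). [cite: JacobsonWilliams2008, §3.3 Table 3.1] -/
theorem classNumber_mul_regulator_of_discr_eq_seventeen (h2 : finrank ℚ K = 2)
    (hd : NumberField.discr K = 17) :
    (NumberField.classNumber K : ℝ) * Units.regulator K = Real.log ((8 + 2 * Real.sqrt 17) / 2) := by
  rw [classNumber_eq_one_of_discr_eq_seventeen h2 hd, regulator_of_discr_eq_seventeen h2 hd, Nat.cast_one,
    one_mul]

/-- `d_K = 21`: `h_K · R_K = log ((5 + √21)/2)`. [cite: JacobsonWilliams2008, §3.3 Table 3.1] -/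
theorem classNumber_mul_regulator_of_discr_eq_twentyOne (h2 : finrank ℚ K = 2)
    (hd : NumberField.discr K = 21) :
    (NumberField.classNumber K : ℝ) * Units.regulator K = Real.log ((5 + 1 * Real.sqrt 21) / 2) := by
  rw [classNumber_eq_one_of_discr_eq_twentyOne h2 hd, regulator_of_discr_eq_twentyOne h2 hd, Nat.cast_one,
    one_mul]

/-- `d_K = 24`: `h_K · R_K = log (5 + 2√6)` (`ε₂₄ = (10 + 2√24)/2`). [cite: JacobsonWilliams2008, §3.3 Table 3.1] -/
theorem classNumber_mul_regulator_of_discr_eq_twentyFour (h2 : finrank ℚ K = 2)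
    (hd : NumberField.discr K = 24) :
    (NumberField.classNumber K : ℝ) * Units.regulator K = Real.log ((10 + 2 * Real.sqrt 24) / 2) := by
  rw [classNumber_eq_one_of_discr_eq_twentyFour h2 hd, regulator_of_discr_eq_twentyFour h2 hd, Nat.cast_one,
    one_mul]

/-- `d_K = 28`: `h_K · R_K = log (8 + 3√7)` (`ε₂₈ = (16 + 3√28)/2`). [cite: JacobsonWilliams2008, §3.3 Table 3.1] -/
theorem classNumber_mul_regulator_of_discr_eq_twentyEight (h2 : finrank ℚ K = 2)
    (hd : NumberField.discr K = 28) :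
    (NumberField.classNumber K : ℝ) * Units.regulator K = Real.log ((16 + 3 * Real.sqrt 28) / 2) := by
  rw [classNumber_eq_one_of_discr_eq_twentyEight h2 hd, regulator_of_discr_eq_twentyEight h2 hd, Nat.cast_one,
    one_mul]

/-- `d_K = 29`: `h_K · R_K = log ((5 + √29)/2)`. [cite: JacobsonWilliams2008, §3.3 Table 3.1] -/
theorem classNumber_mul_regulator_of_discr_eq_twentyNine (h2 : finrank ℚ K = 2)
    (hd : NumberField.discr K = 29) :
    (NumberField.classNumber K : ℝ) * Units.regulator K = Real.log ((5 + 1 * Real.sqrt 29) / 2) := by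
  rw [classNumber_eq_one_of_discr_eq_twentyNine h2 hd, regulator_of_discr_eq_twentyNine h2 hd, Nat.cast_one,
    one_mul]

end Literature.NumberTheory.QuadraticFields.Quadratic

end
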